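import Mathlib.Analysis.SpecialFunctions.Pow.Real
import Literature.Computability.Complexity.CircuitClassesProofs
import Literature.Computability.Complexity.CircuitInputMap
import Literature.Computability.Complexity.FormulaComposition
import Literature.Computability.MetaComplexity.FormulaModelsAE
import Literature.Computability.MetaComplexity.ChenJinWilliams2019.SparseFormulaMagnification
import Literature.Computability.MetaComplexity.ChenJinWilliams2019.SparseMagnificationConverse
import HarnessLib

/-!
# Chen–Jin–Williams 2019, Theorem 1.1, converse of item 4 (`C = NP`, De Morgan formulas) — proved

Discharge (D-0014) of the vendored named fact
`Literature.Computability.MetaComplexity.ChenJinWilliams2019.thm11_item4_NP_converse`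
(`SparseFormulaMagnification.lean`): `NPNotInFixedPolyFormulas → ∃ ε > 0, SparseNPFormulaHardAt ε`,
i.e. if for every `k` some `NP` language is outside `FORMULAae (n ↦ n^k)` (De Morgan formulas of
leaf size `n^k`, almost everywhere), then for every `β ∈ (0,1)` some `2^{n^β}`-sparse `NP` language
is outside `FORMULAae (n ↦ ⌈n^{3+ε}⌉)` (here with `ε = 1`).

Printed proof (L. Chen, C. Jin, R. R. Williams, *Hardness Magnification for all Sparse NP
Languages*, FOCS 2019; full version ECCC TR19-118, §4.1 p. 14, verbatim): *"The ⇐ direction can be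
proved by a simple padding argument. Set `ε = 1`. For every `β ∈ (0, 1)`, by assumption, there is a
language `L_β ∈ NP` without `n^{2/β}` size circuits. Then we can define another language `L'_β ∈ NP`
as `{x10^{|x|^{1/β}−|x|−1} | x ∈ L_β}`. Clearly, `L'_β` does not have `n^{1+ε} = n²` size
circuits, and it is a `2^{n^β}`-sparse language. This padding argument also works for other
computational models (except the last two items in the theorem statement)."*

## The formal proof (same argument, tree vocabulary; the constants of the pad)

As for the circuit and branching-program items (`SparseMagnificationConverse.lean`,
`SparseBPMagnificationConverse.lean`) the padded language is the tree's `polyPad q '' L =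
{⟨x, 1^{|x|^q}⟩ | x ∈ L}` (`q = ⌈1/β⌉`; pair code: the payload bits doubled, the separator `01`,
then `1^{n^q}`), whose `NP` membership and `2^{n^β}`-sparsity are imported. The hardness transfer
"a small formula for the pad restricts to a small formula for `L`" needs one remark in the model
`FORMULAae` of this tree: the De Morgan basis `{∧₂, ∨₂, ¬}` has NO constants, so the constant
positions of the pad cannot simply be hard-wired. They are wired to VARIABLES instead: for a pair
`(i, i')` of payload variables let `ρ_{i,i'}` send the doubled payload positions to their variable,
the constant-`1` positions (second separator bit, the block `1^{n^q}`) to `x_i` and the constant-`0`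
position (first separator bit) to `x_{i'}`. On every input with `x_i = 1`, `x_{i'} = 0` the RENAMED
formula `F ∘ ρ_{i,i'}` (`Circuit.mapInputs`, same gates) reads exactly the pad of the input. Hence
`⋁_{(i,i')} (x_i ∧ ¬x_{i'} ∧ F ∘ ρ_{i,i'})`, together with the disjuncts `⋀ᵢ xᵢ` resp. `⋀ᵢ ¬xᵢ`
when `1ⁿ ∈ L` resp. `0ⁿ ∈ L` (every input other than `1ⁿ, 0ⁿ` has such a pair), is a De Morgan
formula for `L` at length `n` of leaf size `≤ n²·(s(N) + 2) + 2n`, `N = 2n + 2 + n^q`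
(`exists_guardedPad_formula`). With `s(N) = ⌈N^{3+1}⌉ = N⁴ ≤ 625·n^{4q}` this is `≤ n^{4q+3}`
for `n ≥ 629`, contradicting the choice of `L ∉ FORMULAae (n ↦ n^{4q+3})` by
`NPNotInFixedPolyFormulas`.

Bookkeeping proved here for the tree's straight-line formulas (`Circuit`, leaf size
`Circuit.leafSize` of `FormulaModelsAE.lean`, clean formulas of `FormulaComposition.lean`): leaf
size of `binop` / `bigOr` / `bigAnd` / `mapInputs`, reference counts under `mapInputs`, the one-leaf
formula `¬xᵢ`, and the truncation of a formula behind its output gate (`exists_clean_formula`: an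
equivalent clean formula over the same basis with no more leaves).

Main results: `sparseNPFormulaHardAt_one_of_NPNotInFixedPolyFormulas` (the quantitative form,
`ε = 1`), `thm11_item4_NP_converse_holds : thm11_item4_NP_converse`, and the hypothesis-reduced
equivalence `sparseNPFormulaHard_iff_of_thm11_item4`.

## References

* L. Chen, C. Jin, R. R. Williams, *Hardness Magnification for all Sparse NP Languages*, FOCS 2019,
  1240–1255; ECCC TR19-118, Thm. 1.1 and §4.1 (p. 14, "The ⇐ direction … This padding argument
  also works for other computational models"). [bib: ChenJinWilliams2019]
* H. Vollmer, *Introduction to Circuit Complexity* (1999), §1.2 (projections; formulas as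
  fan-out-one circuits). [bib: Vollmer1999]
* S. Jukna, *Boolean Function Complexity* (2012), §1.2 (De Morgan formulas, leaf size). [bib: Jukna2012]
-/

noncomputable section

namespace Literature.Computability.Complexity

open Finset GateList
open Literature.Computability.MetaComplexity

variable {ι κ : Type*}

/-! ### Leaf-size and reference-count bookkeeping -/

namespace GateList

/-- Relocation along wires into INPUTS keeps the side (input / gate) of every wire. [folklore] -/
private theorem isLeft_shiftWire_inl {ρ : ι → κ ⊕ ℕ} (hρ : ∀ i, (ρ i).isLeft = true) (L : ℕ)
    (w : ι ⊕ ℕ) : (shiftWire ρ L w).isLeft = w.isLeft := by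
  cases w with
  | inl i => exact hρ i
  | inr m => rfl

/-- Relocation along wires into inputs keeps the number of input slots of a gate. [folklore] -/
private theorem countP_args_reloc_inl {ρ : ι → κ ⊕ ℕ} (hρ : ∀ i, (ρ i).isLeft = true) (L : ℕ)
    (g : Gate ι) :
    (List.ofFn (reloc ρ L g).args).countP (fun w => w.isLeft) =
      (List.ofFn g.args).countP fun w => w.isLeft := by
  have h : List.ofFn (reloc ρ L g).args = (List.ofFn g.args).map (shiftWire ρ L) := by
    rw [List.map_ofFn]
    rfl
  rw [h, List.countP_map]
  congr 1
  funext w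
  exact isLeft_shiftWire_inl hρ L w

/-- Relocation along input wires behind the empty program keeps the slot counts. [folklore] -/
private theorem slotCount_reloc_inl_zero (e : ι → κ) (m : ℕ) (g : Gate ι) :
    (reloc (fun i => (Sum.inl (e i) : κ ⊕ ℕ)) 0 g).slotCount m = g.slotCount m := by
  unfold Gate.slotCount
  refine congrArg Finset.card (Finset.filter_congr fun a _ => ?_)
  change (shiftWire (fun i => (Sum.inl (e i) : κ ⊕ ℕ)) 0 (g.args a)).getRight? = some m ↔
    (g.args a).getRight? = some m
  cases g.args a <;> simp [shiftWire]

/-- The sum of a prefix of a list of naturals is at most the whole sum. [folklore] -/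
private theorem sum_take_le (l : List ℕ) (k : ℕ) : (l.take k).sum ≤ l.sum := by
  calc (l.take k).sum ≤ (l.take k).sum + (l.drop k).sum := Nat.le_add_right _ _
    _ = l.sum := by rw [← List.sum_append, List.take_append_drop]

/-- The input slots of a two-wire gate. [folklore] -/
private theorem countP_ofFn_two (p : ι ⊕ ℕ → Bool) (u v : ι ⊕ ℕ) :
    (List.ofFn ![u, v]).countP p = (if p u then 1 else 0) + (if p v then 1 else 0) := by
  rw [List.ofFn_succ, List.ofFn_succ, List.ofFn_zero]
  simp only [Matrix.cons_val_zero, Matrix.cons_val_succ, List.countP_cons, List.countP_nil]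
  split_ifs <;> simp_all

end GateList

namespace Circuit

/-- **Leaf size of `C₁ ⋄ C₂`**: the leaves of `C₁` and of `C₂` (the new gate's two slots are leaves
exactly when the corresponding output wire is a bare input). [cite: Jukna2012, §1.2] -/
theorem leafSize_binop (op : (Fin 2 → Bool) → Bool) (C₁ C₂ : Circuit ι) :
    (binop op C₁ C₂).leafSize = C₁.leafSize + C₂.leafSize := by
  unfold Circuit.leafSize
  show ((C₁.gates ++ C₂.gates.map (reloc (fun i => (Sum.inl i : ι ⊕ ℕ)) C₁.gates.length) ++
      [(⟨2, op, ![C₁.output, shiftWire (fun i => (Sum.inl i : ι ⊕ ℕ)) C₁.gates.length C₂.output]⟩ :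
        Gate ι)]).map (fun g : Gate ι => (List.ofFn g.args).countP fun w => w.isLeft)).sum +
      (if (Sum.inr (C₁.gates.length + C₂.gates.length) : ι ⊕ ℕ).isLeft then 1 else 0) = _
  have hρ : ∀ i : ι, ((fun i => (Sum.inl i : ι ⊕ ℕ)) i).isLeft = true := fun _ => rfl
  rw [List.map_append, List.map_append, List.sum_append, List.sum_append, List.map_singleton,
    List.sum_singleton, List.map_map]
  have hrel : (C₂.gates.map ((fun g : Gate ι => (List.ofFn g.args).countP fun w => w.isLeft) ∘
      reloc (fun i => (Sum.inl i : ι ⊕ ℕ)) C₁.gates.length)).sum =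
      (C₂.gates.map fun g => (List.ofFn g.args).countP fun w => w.isLeft).sum := by
    congr 1
    exact List.map_congr_left fun g _ => countP_args_reloc_inl hρ C₁.gates.length g
  have hnew : (List.ofFn (![C₁.output, shiftWire (fun i => (Sum.inl i : ι ⊕ ℕ)) C₁.gates.length
      C₂.output] : Fin 2 → ι ⊕ ℕ)).countP (fun w => w.isLeft) =
      (if C₁.output.isLeft then 1 else 0) + (if C₂.output.isLeft then 1 else 0) := by
    rw [countP_ofFn_two, isLeft_shiftWire_inl hρ]
  have hout : (if (Sum.inr (C₁.gates.length + C₂.gates.length) : ι ⊕ ℕ).isLeft then 1 else 0) = 0 :=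
    rfl
  rw [hrel, hnew, hout]
  generalize (if C₁.output.isLeft = true then 1 else 0) = a
  generalize (if C₂.output.isLeft = true then 1 else 0) = b
  omega

/-- **Leaf size under renaming of inputs**: unchanged (same gates, input slots stay input slots).
[cite: Vollmer1999, §1.2] -/
theorem leafSize_mapInputs (e : ι → κ) (C : Circuit ι) : (C.mapInputs e).leafSize = C.leafSize := by
  unfold Circuit.leafSize
  show ((C.gates.map (reloc (fun i => Sum.inl (e i)) 0)).map fun g =>
      (List.ofFn g.args).countP fun w => w.isLeft).sum +
      (if (shiftWire (fun i => Sum.inl (e i)) 0 C.output).isLeft then 1 else 0) = _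
  have hρ : ∀ i : ι, ((fun i => (Sum.inl (e i) : κ ⊕ ℕ)) i).isLeft = true := fun _ => rfl
  rw [List.map_map, isLeft_shiftWire_inl hρ]
  congr 2
  exact List.map_congr_left fun g _ => countP_args_reloc_inl hρ 0 g

/-- **Reference counts under renaming of inputs**: unchanged. [cite: Vollmer1999, §1.2] -/
theorem refCount_mapInputs (e : ι → κ) (C : Circuit ι) (m : ℕ) :
    (C.mapInputs e).refCount m = C.refCount m := by
  rw [refCount_eq_sum_slotCount, refCount_eq_sum_slotCount]
  show ((C.gates.map (reloc (fun i => Sum.inl (e i)) 0)).map (Gate.slotCount m)).sum = _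
  rw [List.map_map]
  congr 1
  exact List.map_congr_left fun g _ => slotCount_reloc_inl_zero e m g

/-- Renaming inputs keeps clean formulas clean formulas. [cite: Vollmer1999, §1.2] -/
theorem isFormula_mapInputs (e : ι → κ) {C : Circuit ι} (hF : C.IsFormula)
    (hc : ∀ m, C.output = .inr m → C.refCount m = 0) :
    (C.mapInputs e).IsFormula ∧ ∀ m, (C.mapInputs e).output = .inr m → (C.mapInputs e).refCount m = 0 := by
  refine ⟨fun m => by rw [refCount_mapInputs]; exact hF m, fun m hm => ?_⟩
  rw [refCount_mapInputs]
  change shiftWire (fun i => Sum.inl (e i)) 0 C.output = .inr m at hm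
  cases hC : C.output with
  | inl i => rw [hC] at hm; cases hm
  | inr m' =>
    rw [hC] at hm
    simp only [shiftWire, Nat.add_zero, Sum.inr.injEq] at hm
    subst hm
    exact hc m' hC

/-- A gate beyond position `length − 1` is referenced by nobody: in particular the LAST gate of a
program is referenced by no gate (acyclicity). [folklore] -/
private theorem refCount_eq_zero_of_length_le_succ (C : Circuit ι) {m : ℕ}
    (hm : C.gates.length ≤ m + 1) : C.refCount m = 0 := by
  rw [refCount_eq_sum_slotCount]
  apply List.sum_eq_zero
  intro c hc
  rw [List.mem_map] at hc
  obtain ⟨g, hg, rfl⟩ := hc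
  obtain ⟨p, hp, rfl⟩ := List.mem_iff_getElem.1 hg
  unfold Gate.slotCount
  rw [card_eq_zero, filter_eq_empty_iff]
  intro a _ ha
  rw [Sum.getRight?_eq_some_iff] at ha
  have := C.wf p hp a m ha
  omega

/-- **Iterated disjunctions add up leaf sizes.** [cite: Jukna2012, §1.2] -/
theorem leafSize_bigOr : ∀ (k : ℕ) (F : Fin (k + 1) → Circuit ι),
    (bigOr k F).leafSize = ∑ i, (F i).leafSize
  | 0, F => by simp [bigOr]
  | k + 1, F => by
    rw [bigOr, leafSize_binop, leafSize_bigOr k]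
    exact (Fin.sum_univ_succ fun i => (F i).leafSize).symm

/-- **Iterated conjunctions add up leaf sizes.** [cite: Jukna2012, §1.2] -/
theorem leafSize_bigAnd : ∀ (k : ℕ) (F : Fin (k + 1) → Circuit ι),
    (bigAnd k F).leafSize = ∑ i, (F i).leafSize
  | 0, F => by simp [bigAnd]
  | k + 1, F => by
    rw [bigAnd, leafSize_binop, leafSize_bigAnd k]
    exact (Fin.sum_univ_succ fun i => (F i).leafSize).symm

/-- **Truncation behind the output gate.** Every formula over a basis `B` is equivalent to a CLEAN
formula over `B` (its output gate referenced by no gate — the hypothesis of `isFormula_binop`) with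
no more leaves: keep the gates up to the output gate (later gates are dangling), or the bare input
if the output is an input wire. [cite: Jukna2012, §1.2] -/
theorem exists_clean_formula {B : Set GateFn} (C : Circuit ι) (hB : C.IsOver B)
    (hF : C.IsFormula) :
    ∃ C' : Circuit ι, C'.IsOver B ∧ C'.IsFormula ∧ (∀ m, C'.output = .inr m → C'.refCount m = 0) ∧
      C'.leafSize ≤ C.leafSize ∧ ∀ x, C'.eval x = C.eval x := by
  rcases hC : C.output with i | m
  · refine ⟨input i, isOver_input B i, (isFormula_input i).1, (isFormula_input i).2, ?_, fun x => ?_⟩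
    · rw [leafSize_input]
      unfold Circuit.leafSize
      rw [hC]
      simp
    · rw [eval_input, circuit_eval C, hC, wireOf_inl]
  · have hm : m < C.gates.length := C.wf_output m hC
    have hsplit : C.gates.take (m + 1) ++ C.gates.drop (m + 1) = C.gates := List.take_append_drop _ _
    have hwf : WF (C.gates.take (m + 1)) := by
      have h := wf_gates C
      rw [← hsplit] at h
      exact h.of_append_left
    have hlen : (C.gates.take (m + 1)).length = m + 1 := by
      rw [List.length_take]; omega
    refine ⟨toCircuit (C.gates.take (m + 1)) (.inr m) hwf (fun m' h => by cases h; omega),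
      fun g hg => hB g (List.mem_of_mem_take hg), fun m' => ?_, fun m' hm' => ?_, ?_, fun x => ?_⟩
    · -- reference counts only go down
      refine le_trans ?_ (hF m')
      rw [refCount_eq_sum_slotCount, refCount_eq_sum_slotCount]
      show ((C.gates.take (m + 1)).map (Gate.slotCount m')).sum ≤ (C.gates.map (Gate.slotCount m')).sum
      rw [List.map_take]
      exact sum_take_le _ _
    · -- the output gate is the last one
      cases hm'
      exact refCount_eq_zero_of_length_le_succ _ (by show (C.gates.take (m + 1)).length ≤ m + 1; omega)
    · unfold Circuit.leafSize
      rw [hC]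
      show ((C.gates.take (m + 1)).map fun g => (List.ofFn g.args).countP fun w => w.isLeft).sum +
          (if (Sum.inr m : ι ⊕ ℕ).isLeft then 1 else 0) ≤ _
      simp only [Sum.isLeft_inr, Nat.add_zero, Bool.false_eq_true, if_false]
      rw [List.map_take]
      exact sum_take_le _ _
    · rw [circuit_eval, circuit_eval C, hC]
      show wireOf x (vals (C.gates.take (m + 1)) x) (.inr m) = wireOf x (vals C.gates x) (.inr m)
      obtain ⟨ws, hws⟩ := vals_append_take (C.gates.take (m + 1)) (C.gates.drop (m + 1)) x
      rw [hsplit] at hws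
      rw [hws, wireOf_append_of_lt]
      intro m' h
      cases h
      rw [length_vals, hlen]
      exact Nat.lt_succ_self m

/-- **The one-leaf formula `¬xᵢ`** (one negation gate reading the input `xᵢ`): a clean De Morgan
formula of leaf size `1`. [cite: Jukna2012, §1.2] -/
theorem exists_negInput (i : ι) :
    ∃ G : Circuit ι, G.IsOver deMorganBasis ∧ G.IsFormula ∧
      (∀ m, G.output = .inr m → G.refCount m = 0) ∧ G.leafSize = 1 ∧ ∀ x, G.eval x = !x i := by
  have hwf : WF [notGate (Sum.inl i : ι ⊕ ℕ)] :=
    WF.singleton fun a m h => by simp [notGate] at h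
  refine ⟨toCircuit [notGate (Sum.inl i)] (.inr 0) hwf (fun m h => by cases h; simp),
    ?_, fun m => ?_, fun m _ => ?_, ?_, fun x => ?_⟩
  · intro g hg
    simp only [toCircuit, List.mem_singleton] at hg
    subst hg
    rw [notGate_fn]
    simp [deMorganBasis]
  · -- the single slot is an input wire
    rw [refCount_eq_sum_slotCount]
    show ([notGate (Sum.inl i : ι ⊕ ℕ)].map (Gate.slotCount m)).sum ≤ 1
    simp [Gate.slotCount, notGate]
  · rw [refCount_eq_sum_slotCount]
    show ([notGate (Sum.inl i : ι ⊕ ℕ)].map (Gate.slotCount m)).sum = 0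
    simp [Gate.slotCount, notGate]
  · unfold Circuit.leafSize
    show ([notGate (Sum.inl i : ι ⊕ ℕ)].map fun g => (List.ofFn g.args).countP fun w => w.isLeft).sum
        + (if (Sum.inr 0 : ι ⊕ ℕ).isLeft then 1 else 0) = 1
    simp [notGate, List.ofFn_succ]
  · rw [circuit_eval]
    show wireOf x (vals ([] ++ [notGate (Sum.inl i : ι ⊕ ℕ)]) x) (.inr 0) = !x i
    rw [vals_append_singleton]
    simp [notGate]


/-! ### The guarded restriction of a De Morgan formula along the pad `⟨u, 1^m⟩` -/

/-- The wiring `ρ_{i,i'}` of the pad positions to payload variables — doubled payload position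
`2l`, `2l+1` to `x_l`, the separator `0` to `x_{i'}`, the separator `1` and the block `1^m` to
`x_i` — reads exactly the pad `pairVec u 1^m` on every input with `u i = 1`, `u i' = 0`.
[cite: ChenJinWilliams2019, Thm. 1.1 (converse), TR19-118 §4.1 p. 14] -/
theorem comp_padWiring_eq_pairVec {n m : ℕ} (i i' : Fin n) (u : Fin n → Bool) (hi : u i = true)
    (hi' : u i' = false) :
    (fun j => u (Fin.append (Fin.append
        (fun l : Fin (2 * n) => (⟨(l : ℕ) / 2, by have := l.2; omega⟩ : Fin n)) ![i', i])
        (fun _ : Fin m => i) j)) = pairVec u fun _ : Fin m => true := by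
  funext j
  refine Fin.addCases (fun k => ?_) (fun l => ?_) j
  · refine Fin.addCases (fun l => ?_) (fun t => ?_) k
    · simp only [pairVec, Fin.append_left]
    · simp only [pairVec, Fin.append_left, Fin.append_right]
      fin_cases t
      · simpa using hi'
      · simpa using hi
  · simp only [pairVec, Fin.append_right, hi]

/-- **The guarded pad formula.** For a De Morgan formula `F` on the `2n + 2 + m` positions of the pad
`⟨u, 1^m⟩` (`n ≥ 2`) and two bits `b₁, b₀`, there is a De Morgan formula `H` on the `n` payload
variables, of leaf size `≤ n²·(L(F) + 2) + 2n`, with `H(u) = F(⟨u, 1^m⟩)` on every non-constant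
input `u`, `H(1ⁿ) = b₁` and `H(0ⁿ) = b₀`: the disjunction of the guarded renamings
`x_i ∧ ¬x_{i'} ∧ F ∘ ρ_{i,i'}` over all pairs `(i, i')` (the constant pad positions wired to `x_i`
resp. `x_{i'}`), of `⋀ᵢ xᵢ` if `b₁ = 1` and of `⋀ᵢ ¬xᵢ` if `b₀ = 1` — no constant gates are needed.
[cite: ChenJinWilliams2019, Thm. 1.1 (converse of item 4), TR19-118 §4.1 p. 14] -/
theorem exists_guardedPad_formula {k m : ℕ} (F : Circuit (Fin (2 * (k + 2) + 2 + m)))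
    (hB : F.IsOver deMorganBasis) (hF : F.IsFormula) (b₁ b₀ : Bool) :
    ∃ H : Circuit (Fin (k + 2)), H.IsOver deMorganBasis ∧ H.IsFormula ∧
      H.leafSize ≤ (k + 2) * (k + 2) * (F.leafSize + 2) + 2 * (k + 2) ∧
      (∀ u : Fin (k + 2) → Bool, (∃ i i', u i = true ∧ u i' = false) →
          H.eval u = F.eval (pairVec u fun _ : Fin m => true)) ∧
      H.eval (fun _ => true) = b₁ ∧ H.eval (fun _ => false) = b₀ := by
  -- a clean copy of `F`, and the negated inputs `¬xᵢ`
  obtain ⟨F', hB', hF', hc', hleaf', hev'⟩ := F.exists_clean_formula hB hF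
  choose G hGB hGF hGc hGleaf hGev using fun i : Fin (k + 2) => exists_negInput i
  have hand : (⟨2, (GateFn.and 2).2⟩ : GateFn) ∈ deMorganBasis := Set.mem_insert _ _
  have hor : (⟨2, (GateFn.or 2).2⟩ : GateFn) ∈ deMorganBasis :=
    Set.mem_insert_of_mem _ (Set.mem_insert _ _)
  -- the wiring and the guarded terms
  let ρ : Fin (k + 2) → Fin (k + 2) → Fin (2 * (k + 2) + 2 + m) → Fin (k + 2) := fun i i' =>
    Fin.append (Fin.append
      (fun l : Fin (2 * (k + 2)) => (⟨(l : ℕ) / 2, by have := l.2; omega⟩ : Fin (k + 2))) ![i', i])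
      (fun _ : Fin m => i)
  let T : Fin (k + 2) × Fin (k + 2) → Circuit (Fin (k + 2)) := fun p =>
    binop (GateFn.and 2).2 (binop (GateFn.and 2).2 (input p.1) (G p.2)) (F'.mapInputs (ρ p.1 p.2))
  have hTB : ∀ p, (T p).IsOver deMorganBasis := fun p =>
    isOver_binop hand (isOver_binop hand (isOver_input _ _) (hGB _)) (hB'.mapInputs _)
  have hTF : ∀ p, (T p).IsFormula ∧ ∀ m', (T p).output = .inr m' → (T p).refCount m' = 0 := fun p =>
    isFormula_binop _ (isFormula_binop _ (isFormula_input _).1 (isFormula_input _).2 (hGF _)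
      (hGc _)).1 (isFormula_binop _ (isFormula_input _).1 (isFormula_input _).2 (hGF _) (hGc _)).2
      (isFormula_mapInputs _ hF' hc').1 (isFormula_mapInputs _ hF' hc').2
  have hTl : ∀ p, (T p).leafSize ≤ F.leafSize + 2 := by
    intro p
    simp only [T, leafSize_binop, leafSize_input, hGleaf, leafSize_mapInputs]
    omega
  have hTe : ∀ p u, (T p).eval u = ((u p.1 && !u p.2) && F.eval fun j => u (ρ p.1 p.2 j)) := by
    intro p u
    simp only [T, eval_binop, and_two_apply_pair, eval_input, hGev, eval_mapInputs, hev']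
  -- the always-false formula `x₀ ∧ ¬x₀` and the selector `b ∧ P`
  let Z : Circuit (Fin (k + 2)) := binop (GateFn.and 2).2 (input 0) (G 0)
  have hZe : ∀ u, Z.eval u = false := by
    intro u
    simp only [Z, eval_binop, and_two_apply_pair, eval_input, hGev]
    cases u 0 <;> rfl
  have hsel : ∀ (b : Bool) (P : Circuit (Fin (k + 2))), P.IsOver deMorganBasis → P.IsFormula →
      (∀ m', P.output = .inr m' → P.refCount m' = 0) → P.leafSize ≤ k + 2 →
      ∃ A : Circuit (Fin (k + 2)), A.IsOver deMorganBasis ∧ A.IsFormula ∧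
        (∀ m', A.output = .inr m' → A.refCount m' = 0) ∧ A.leafSize ≤ k + 2 ∧
        ∀ u, A.eval u = (b && P.eval u) := by
    intro b P hPB hPF hPc hPl
    cases b
    · refine ⟨Z, isOver_binop hand (isOver_input _ _) (hGB _),
        (isFormula_binop _ (isFormula_input _).1 (isFormula_input _).2 (hGF _) (hGc _)).1,
        (isFormula_binop _ (isFormula_input _).1 (isFormula_input _).2 (hGF _) (hGc _)).2,
        ?_, fun u => by rw [hZe u, Bool.false_and]⟩
      simp only [Z, leafSize_binop, leafSize_input, hGleaf]
      omega
    · exact ⟨P, hPB, hPF, hPc, hPl, fun u => by rw [Bool.true_and]⟩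
  -- `⋀ᵢ xᵢ` and `⋀ᵢ ¬xᵢ`
  have hAll₁ := isFormula_bigAnd (k + 1) (fun i : Fin (k + 2) => (input i : Circuit (Fin (k + 2))))
    fun i => isFormula_input i
  have hAll₀ := isFormula_bigAnd (k + 1) (fun i : Fin (k + 2) => G i) fun i => ⟨hGF i, hGc i⟩
  have hl₁ : (bigAnd (k + 1) fun i : Fin (k + 2) => (input i : Circuit (Fin (k + 2)))).leafSize ≤
      k + 2 := by
    rw [leafSize_bigAnd]
    simp
  have hl₀ : (bigAnd (k + 1) fun i : Fin (k + 2) => G i).leafSize ≤ k + 2 := by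
    rw [leafSize_bigAnd]
    simp [hGleaf]
  obtain ⟨A₁, hA₁B, hA₁F, hA₁c, hA₁l, hA₁e⟩ := hsel b₁ _
    (isOver_bigAnd hand _ _ fun i => isOver_input _ i) hAll₁.1 hAll₁.2 hl₁
  obtain ⟨A₀, hA₀B, hA₀F, hA₀c, hA₀l, hA₀e⟩ := hsel b₀ _
    (isOver_bigAnd hand _ _ fun i => hGB i) hAll₀.1 hAll₀.2 hl₀
  have hA₁t : ∀ u, A₁.eval u = true ↔ b₁ = true ∧ ∀ i, u i = true := by
    intro u
    rw [hA₁e u, eval_bigAnd, Bool.and_eq_true, decide_eq_true_iff]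
    simp only [eval_input]
  have hA₀t : ∀ u, A₀.eval u = true ↔ b₀ = true ∧ ∀ i, u i = false := by
    intro u
    rw [hA₀e u, eval_bigAnd, Bool.and_eq_true, decide_eq_true_iff]
    simp only [hGev, Bool.not_eq_true']
  -- all the disjuncts
  let terms : Fin ((k + 2) * (k + 2) + 2) → Circuit (Fin (k + 2)) :=
    Fin.append (fun c => T (finProdFinEquiv.symm c)) ![A₁, A₀]
  have hterms₁ : terms (Fin.natAdd ((k + 2) * (k + 2)) 0) = A₁ := by
    simp only [terms, Fin.append_right, Matrix.cons_val_zero]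
  have hterms₀ : terms (Fin.natAdd ((k + 2) * (k + 2)) 1) = A₀ := by
    simp only [terms, Fin.append_right, Matrix.cons_val_one, Matrix.cons_val_zero]
  have htermsT : ∀ c, terms (Fin.castAdd 2 c) = T (finProdFinEquiv.symm c) := fun c => by
    simp only [terms, Fin.append_left]
  -- case analysis over the disjuncts
  have hcases : ∀ {P : Circuit (Fin (k + 2)) → Prop}, (∀ p, P (T p)) → P A₁ → P A₀ →
      ∀ c, P (terms c) := by
    intro P hT h₁ h₀ c
    refine Fin.addCases (fun c => ?_) (fun t => ?_) c
    · rw [htermsT]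
      exact hT _
    · fin_cases t
      · exact hterms₁ ▸ h₁
      · exact hterms₀ ▸ h₀
  refine ⟨bigOr ((k + 2) * (k + 2) + 1) terms, isOver_bigOr hor _ _
    (hcases (P := fun C => C.IsOver deMorganBasis) hTB hA₁B hA₀B),
    (isFormula_bigOr _ _ (hcases (P := fun C => C.IsFormula ∧ ∀ m', C.output = .inr m' →
      C.refCount m' = 0) hTF ⟨hA₁F, hA₁c⟩ ⟨hA₀F, hA₀c⟩)).1, ?_, ?_, ?_, ?_⟩
  · -- leaf size
    rw [leafSize_bigOr]
    show (∑ c : Fin ((k + 2) * (k + 2) + 2), (terms c).leafSize) ≤ _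
    rw [Fin.sum_univ_add, Fin.sum_univ_two, hterms₁, hterms₀]
    simp only [htermsT]
    have h1 : (∑ c : Fin ((k + 2) * (k + 2)), (T (finProdFinEquiv.symm c)).leafSize) ≤
        (k + 2) * (k + 2) * (F.leafSize + 2) := by
      calc (∑ c : Fin ((k + 2) * (k + 2)), (T (finProdFinEquiv.symm c)).leafSize)
          ≤ ∑ _c : Fin ((k + 2) * (k + 2)), (F.leafSize + 2) := Finset.sum_le_sum fun c _ => hTl _
        _ = (k + 2) * (k + 2) * (F.leafSize + 2) := by simp
    omega
  · -- non-constant inputs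
    rintro u ⟨i, i', hi, hi'⟩
    have aux : ∀ c : Fin ((k + 2) * (k + 2) + 2), (terms c).eval u = true →
        F.eval (pairVec u fun _ : Fin m => true) = true := by
      refine hcases (P := fun C => C.eval u = true → F.eval (pairVec u fun _ : Fin m => true) = true)
        (fun p hp => ?_) (fun h => ?_) (fun h => ?_)
      · rw [hTe] at hp
        simp only [Bool.and_eq_true, Bool.not_eq_true'] at hp
        obtain ⟨⟨h1, h2⟩, h3⟩ := hp
        rwa [show (fun j => u (ρ _ _ j)) = pairVec u fun _ : Fin m => true from
          comp_padWiring_eq_pairVec _ _ u h1 h2] at h3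
      · have := ((hA₁t u).1 h).2 i'
        rw [hi'] at this
        exact absurd this (by decide)
      · have := ((hA₀t u).1 h).2 i
        rw [hi] at this
        exact absurd this (by decide)
    rw [eval_bigOr, Bool.eq_iff_iff, decide_eq_true_iff]
    constructor
    · rintro ⟨c, hc⟩
      exact aux c hc
    · intro hv
      refine ⟨(Fin.castAdd 2 (finProdFinEquiv (i, i')) : Fin ((k + 2) * (k + 2) + 2)), ?_⟩
      show (terms (Fin.castAdd 2 (finProdFinEquiv (i, i')))).eval u = true
      rw [htermsT, Equiv.symm_apply_apply, hTe]
      simp only [hi, hi', Bool.not_false, Bool.true_and]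
      rw [show (fun j => u (ρ i i' j)) = pairVec u fun _ : Fin m => true from
        comp_padWiring_eq_pairVec i i' u hi hi', hv]
  · -- the all-ones input
    have aux : ∀ c : Fin ((k + 2) * (k + 2) + 2), (terms c).eval (fun _ => true) = true →
        b₁ = true := by
      refine hcases (P := fun C => C.eval (fun _ => true) = true → b₁ = true)
        (fun p hp => ?_) (fun h => ?_) (fun h => ?_)
      · rw [hTe] at hp
        simp at hp
      · exact ((hA₁t _).1 h).1
      · exact absurd (((hA₀t _).1 h).2 0) (by decide)
    rw [eval_bigOr, Bool.eq_iff_iff, decide_eq_true_iff]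
    constructor
    · rintro ⟨c, hc⟩
      exact aux c hc
    · intro hb
      refine ⟨(Fin.natAdd ((k + 2) * (k + 2)) 0 : Fin ((k + 2) * (k + 2) + 2)), ?_⟩
      show (terms (Fin.natAdd ((k + 2) * (k + 2)) 0)).eval (fun _ => true) = true
      rw [hterms₁]
      exact (hA₁t _).2 ⟨hb, fun _ => rfl⟩
  · -- the all-zeros input
    have aux : ∀ c : Fin ((k + 2) * (k + 2) + 2), (terms c).eval (fun _ => false) = true →
        b₀ = true := by
      refine hcases (P := fun C => C.eval (fun _ => false) = true → b₀ = true)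
        (fun p hp => ?_) (fun h => ?_) (fun h => ?_)
      · rw [hTe] at hp
        simp at hp
      · exact absurd (((hA₁t _).1 h).2 0) (by decide)
      · exact ((hA₀t _).1 h).1
    rw [eval_bigOr, Bool.eq_iff_iff, decide_eq_true_iff]
    constructor
    · rintro ⟨c, hc⟩
      exact aux c hc
    · intro hb
      refine ⟨(Fin.natAdd ((k + 2) * (k + 2)) 1 : Fin ((k + 2) * (k + 2) + 2)), ?_⟩
      show (terms (Fin.natAdd ((k + 2) * (k + 2)) 1)).eval (fun _ => false) = true
      rw [hterms₀]
      exact (hA₀t _).2 ⟨hb, fun _ => rfl⟩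

end Circuit

end Literature.Computability.Complexity

namespace Literature.Computability.MetaComplexity

open Literature.Computability.Complexity

namespace ChenJinWilliams2019

open Literature.Computability.Complexity.Nondeterministic Literature.Computability.Complexity.Brick

/-! ### The padded language `polyPad q '' L` (as in the circuit and branching-program files) -/

/-- A pad lies in the padded language iff its payload lies in `L` (`polyPad q` is injective: its
first component is the payload). [folklore] -/
private theorem polyPad_mem_image_iff {q : ℕ} {L : Language Bool} {x : List Bool} :
    polyPad q x ∈ polyPad q '' L ↔ x ∈ L :=
  (show Function.Injective (polyPad q) from fun x y h => by simpa using congrArg fstF h).mem_set_image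

/-- The indicator of the padded language at a pad is the indicator of `L` at the payload.
[folklore] -/
private theorem boolIndicator_image_polyPad (q : ℕ) (L : Language Bool) (x : List Bool) :
    (polyPad q '' L).boolIndicator (polyPad q x) = (L : Set (List Bool)).boolIndicator x := by
  by_cases hx : x ∈ L
  · rw [((polyPad q '' L).mem_iff_boolIndicator _).1 (polyPad_mem_image_iff.2 hx),
      ((L : Set (List Bool)).mem_iff_boolIndicator _).1 hx]
  · rw [((polyPad q '' L).notMem_iff_boolIndicator _).1
        (fun h => hx (polyPad_mem_image_iff.1 h)),
      ((L : Set (List Bool)).notMem_iff_boolIndicator _).1 hx]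

/-! ### Hardness transfer (print: "This padding argument also works for other computational models") -/

/-- `⌈N^{3+1}⌉ = N⁴`. [folklore] -/
private theorem powCeil_three_add_one (N : ℕ) : powCeil (3 + 1) N = N ^ 4 := by
  unfold powCeil
  rw [show (3 : ℝ) + 1 = ((4 : ℕ) : ℝ) by norm_num, Real.rpow_natCast, ← Nat.cast_pow,
    Nat.ceil_natCast]

/-- Size bookkeeping of the transfer: for `1 ≤ q` and `n ≥ 629`,
`n²·((2n + 2 + n^q)⁴ + 2) + 2n ≤ 629·n^{4q+2} ≤ n^{4q+3}`. [folklore] -/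
private theorem padLeaf_le {q : ℕ} (hq : 1 ≤ q) {n : ℕ} (hn : 629 ≤ n) :
    n * n * ((2 * n + 2 + n ^ q) ^ 4 + 2) + 2 * n ≤ n ^ (4 * q + 3) := by
  have hnq : n ≤ n ^ q := Nat.le_self_pow (by omega) n
  have h5 : 2 * n + 2 + n ^ q ≤ 5 * n ^ q := by omega
  have h4 : (2 * n + 2 + n ^ q) ^ 4 ≤ 625 * n ^ (4 * q) :=
    calc (2 * n + 2 + n ^ q) ^ 4 ≤ (5 * n ^ q) ^ 4 := Nat.pow_le_pow_left h5 4
      _ = 625 * n ^ (4 * q) := by ring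
  have h1 : 0 < n ^ (4 * q) := Nat.pos_of_ne_zero (pow_ne_zero _ (by omega))
  have h2 : n ≤ n * n * n ^ (4 * q) := by
    rw [mul_assoc]
    exact Nat.le_mul_of_pos_right n (Nat.mul_pos (by omega) h1)
  have h3 : (2 * n + 2 + n ^ q) ^ 4 + 2 ≤ 627 * n ^ (4 * q) := by omega
  calc n * n * ((2 * n + 2 + n ^ q) ^ 4 + 2) + 2 * n
      ≤ n * n * (627 * n ^ (4 * q)) + 2 * (n * n * n ^ (4 * q)) :=
        Nat.add_le_add (Nat.mul_le_mul_left _ h3) (Nat.mul_le_mul_left _ h2)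
    _ = 629 * (n * n * n ^ (4 * q)) := by ring
    _ ≤ n * (n * n * n ^ (4 * q)) := Nat.mul_le_mul_right _ hn
    _ = n ^ (4 * q + 3) := by ring

/-- Every bit vector is non-constant, all ones, or all zeros. [folklore] -/
private theorem exists_pair_or_eq_const {n : ℕ} (u : Fin n → Bool) :
    (∃ i i', u i = true ∧ u i' = false) ∨ u = (fun _ => true) ∨ u = (fun _ => false) := by
  by_cases h0 : ∃ i', u i' = false
  · by_cases h1 : ∃ i, u i = true
    · obtain ⟨i, hi⟩ := h1
      obtain ⟨i', hi'⟩ := h0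
      exact Or.inl ⟨i, i', hi, hi'⟩
    · refine Or.inr (Or.inr (funext fun i => ?_))
      simpa using not_exists.1 h1 i
  · refine Or.inr (Or.inl (funext fun i => ?_))
    simpa using not_exists.1 h0 i

/-- **Hardness transfer by padding, De Morgan formulas.** If the padded language `polyPad q '' L`
(`1 ≤ q`) has De Morgan formulas of leaf size `≤ ⌈N^{3+1}⌉ = N⁴` at every large length `N`, then
`L` has De Morgan formulas of leaf size `≤ n^{4q+3}` at every large length `n`: at length `n ≥ 629`
take the guarded pad formula (`Circuit.exists_guardedPad_formula`) of the formula for length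
`N = 2n + 2 + n^q`, with the two bits `[1ⁿ ∈ L]`, `[0ⁿ ∈ L]`; its leaf size is
`≤ n²(N⁴ + 2) + 2n ≤ n^{4q+3}` (`padLeaf_le`). At small lengths use any circuit for the slice.
[cite: ChenJinWilliams2019, Thm. 1.1 (converse of item 4), TR19-118 §4.1 p. 14] -/
theorem mem_FORMULAae_of_image_polyPad_mem_FORMULAae {q : ℕ} (hq : 1 ≤ q) {L : Language Bool}
    (h : polyPad q '' L ∈ FORMULAae (powCeil (3 + 1))) :
    L ∈ FORMULAae fun n => n ^ (4 * q + 3) := by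
  obtain ⟨C, ⟨N₀, hN₀⟩, hdec⟩ := h
  -- the pad of `u` is read by the formula for the padded language as `[ofFn u ∈ L]`
  have hpad : ∀ (n : ℕ) (u : Fin n → Bool), (C (2 * n + 2 + n ^ q)).eval
      (pairVec u fun _ : Fin (n ^ q) => true) = (L : Set (List Bool)).boolIndicator (List.ofFn u) := by
    intro n u
    rw [hdec.eval_eq, ofFn_pairVec, List.ofFn_const]
    have hpad : boolPair (List.ofFn u) (List.replicate (n ^ q) true) = polyPad q (List.ofFn u) := by
      rw [polyPad, List.length_ofFn]
    rw [hpad, boolIndicator_image_polyPad]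
  -- at every length `n = k + 2` whose pad is long enough: the guarded pad formula decides `L`
  have main : ∀ k : ℕ, N₀ ≤ 2 * (k + 2) + 2 + (k + 2) ^ q →
      ∃ H : Circuit (Fin (k + 2)), H.IsOver deMorganBasis ∧ H.IsFormula ∧
        H.leafSize ≤ (k + 2) * (k + 2) * ((2 * (k + 2) + 2 + (k + 2) ^ q) ^ 4 + 2) + 2 * (k + 2) ∧
        ∀ u : Fin (k + 2) → Bool, H.eval u = (L : Set (List Bool)).boolIndicator (List.ofFn u) := by
    intro k hk
    obtain ⟨hB, hF, hl⟩ := hN₀ _ hk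
    rw [powCeil_three_add_one] at hl
    obtain ⟨H, hHB, hHF, hHl, hmix, h₁, h₀⟩ := (C (2 * (k + 2) + 2 + (k + 2) ^ q))
      |>.exists_guardedPad_formula hB hF
        ((L : Set (List Bool)).boolIndicator (List.ofFn fun _ : Fin (k + 2) => true))
        ((L : Set (List Bool)).boolIndicator (List.ofFn fun _ : Fin (k + 2) => false))
    refine ⟨H, hHB, hHF,
      hHl.trans (Nat.add_le_add_right (Nat.mul_le_mul_left _ (Nat.add_le_add_right hl 2)) _),
      fun u => ?_⟩
    rcases exists_pair_or_eq_const u with hu | rfl | rfl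
    · rw [hmix u hu, hpad]
    · exact h₁
    · exact h₀
  -- the family: guarded pad formulas from `max N₀ 629` on, anything before
  have family : ∀ n : ℕ, ∃ D : Circuit (Fin n),
      (max N₀ 629 ≤ n → D.IsOver deMorganBasis ∧ D.IsFormula ∧ D.leafSize ≤ n ^ (4 * q + 3)) ∧
      ∀ u : Fin n → Bool, D.eval u = (L : Set (List Bool)).boolIndicator (List.ofFn u) := by
    intro n
    by_cases hn : max N₀ 629 ≤ n
    · have h629 : 629 ≤ n := le_of_max_le_right hn
      have hN₀n : N₀ ≤ n := le_of_max_le_left hn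
      obtain ⟨k, rfl⟩ : ∃ k, n = k + 2 := ⟨n - 2, by omega⟩
      have hN : N₀ ≤ 2 * (k + 2) + 2 + (k + 2) ^ q := hN₀n.trans (by omega)
      obtain ⟨H, hHB, hHF, hHl, hHe⟩ := main k hN
      exact ⟨H, fun _ => ⟨hHB, hHF, hHl.trans (padLeaf_le hq h629)⟩, hHe⟩
    · obtain ⟨D, -, hD⟩ :=
        exists_circuit_eval_eq n fun u => (L : Set (List Bool)).boolIndicator (List.ofFn u)
      exact ⟨D, fun h => absurd h hn, hD⟩
  choose D hD using family
  refine ⟨D, ⟨max N₀ 629, fun n hn => (hD n).1 hn⟩, fun x => ?_⟩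
  have := (hD x.length).2 x.get
  rwa [List.ofFn_get] at this

/-! ### The named fact -/

/-- **Chen–Jin–Williams 2019, Thm. 1.1, converse of item 4 (`C = NP`), quantitative form with
`ε = 1`:** if for every `k` some `NP` language is outside `FORMULAae (n ↦ n^k)`, then for every
`β ∈ (0,1)` some `2^{n^β}`-sparse `NP` language is outside `FORMULAae (n ↦ ⌈n^{3+1}⌉)` — namely
the pad `{⟨x, 1^{|x|^q}⟩ | x ∈ L}`, `q = ⌈1/β⌉`, of an `NP` language `L ∉ FORMULAae (n ↦ n^{4q+3})`.
Printed: TR19-118 §4.1 p. 14, "The ⇐ direction can be proved by a simple padding argument. Set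
`ε = 1`. … This padding argument also works for other computational models".
[cite: ChenJinWilliams2019, Thm. 1.1 (converse of item 4), TR19-118 §4.1 p. 14] -/
theorem sparseNPFormulaHardAt_one_of_NPNotInFixedPolyFormulas
    (h : ChenJinWilliams2020.NPNotInFixedPolyFormulas) : SparseNPFormulaHardAt 1 := by
  intro β hβ0 _hβ1
  have hq : 1 ≤ ⌈1 / β⌉₊ := Nat.ceil_pos.2 (by positivity)
  have hqβ : 1 ≤ (⌈1 / β⌉₊ : ℝ) * β := by
    have h1 : 1 / β ≤ (⌈1 / β⌉₊ : ℝ) := Nat.le_ceil (1 / β)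
    calc (1 : ℝ) = 1 / β * β := by field_simp
      _ ≤ (⌈1 / β⌉₊ : ℝ) * β := mul_le_mul_of_nonneg_right h1 hβ0.le
  obtain ⟨L, hL, hhard⟩ := h (4 * ⌈1 / β⌉₊ + 3)
  exact ⟨polyPad ⌈1 / β⌉₊ '' L, image_polyPad_mem_NP _ hL, isSparse_image_polyPad hβ0 hqβ L,
    fun hc => hhard (mem_FORMULAae_of_image_polyPad_mem_FORMULAae hq hc)⟩

/-- **Discharge of the named fact `thm11_item4_NP_converse`** (Chen–Jin–Williams 2019, Thm. 1.1,
"Moreover, the converse of each item above also holds", item 4, `C = NP`):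
`NPNotInFixedPolyFormulas → ∃ ε > 0, SparseNPFormulaHardAt ε`, with `ε = 1`.
[cite: ChenJinWilliams2019, Thm. 1.1 (converse of item 4), TR19-118 pp. 4, 14] -/
theorem thm11_item4_NP_converse_holds : thm11_item4_NP_converse :=
  fun h => ⟨1, one_pos, sparseNPFormulaHardAt_one_of_NPNotInFixedPolyFormulas h⟩

/-- Every `ε ∈ [0,1]` works in the converse (antitonicity of `SparseNPFormulaHardAt` in `ε`).
[cite: ChenJinWilliams2019, Thm. 1.1 (converse of item 4), TR19-118 §4.1 p. 14] -/
theorem sparseNPFormulaHardAt_of_NPNotInFixedPolyFormulas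
    (h : ChenJinWilliams2020.NPNotInFixedPolyFormulas) {ε : ℝ} (hε0 : 0 ≤ ε) (hε1 : ε ≤ 1) :
    SparseNPFormulaHardAt ε :=
  (sparseNPFormulaHardAt_one_of_NPNotInFixedPolyFormulas h).anti hε0 hε1

/-- The printed EQUIVALENCE of Thm. 1.1 item 4 (`C = NP`) with only the magnification direction
left as a named-fact hypothesis: the sparse-language De Morgan formula hypothesis (at some `ε > 0`)
holds iff `NP ⊄ Formula[n^k] ∀ k` (`sparseNPFormulaHard_iff` fed with
`thm11_item4_NP_converse_holds`).
[cite: ChenJinWilliams2019, Thm. 1.1 (item 4 and its converse), TR19-118 pp. 3–4, 14] -/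
theorem sparseNPFormulaHard_iff_of_thm11_item4 (h : thm11_item4_NP) :
    (∃ ε : ℝ, 0 < ε ∧ SparseNPFormulaHardAt ε) ↔ ChenJinWilliams2020.NPNotInFixedPolyFormulas :=
  sparseNPFormulaHard_iff h thm11_item4_NP_converse_holds

end ChenJinWilliams2019

end Literature.Computability.MetaComplexity
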